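import Literature.LinearAlgebra.QuadraticForm.WittGroup
import Mathlib.LinearAlgebra.SesquilinearForm.Basic
import Mathlib.Logic.Equiv.Fin.Rotate
import Mathlib.Algebra.BigOperators.Fin
import HarnessLib

/-!
# The Maslov index of `n` Lagrangians as a quadratic form ([Thomas2006, §2, §4])

Topic `LinearAlgebra/QuadraticForm`; namespace `Literature.LinearAlgebra.QuadraticForm`. KERNEL mathematics only
(definitions with bodies + theorems; no named fact, no `axiom`, no `sorry`).

[Thomas2006] (T. Thomas, *The Maslov index as a quadratic space*): "Kashiwara defined the Maslov index (associated
to a collection of Lagrangian subspaces of a symplectic vector space over a field `F`) as a class in the Witt group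
`W(F)` of quadratic forms. We construct a canonical quadratic vector space in this class …". §2.2.1 **Definition.**
"Let `K_{1,2,…,n}` be the kernel of the natural summation `⊕_{i ∈ ℤ/nℤ} l_i → V`." §2.2.2 **Definition** of the
bilinear form `q_{1,2,…,n}` on `K_{1,2,…,n}` through anti-derivatives; **Remark 2**: "one may concretely choose
`∫w_{{i,i+1}} = Σ_{j=1}^i w_j`, in which case the definition takes the simple form
`q(v, w) = Σ_{i ≥ j} B(v_i, w_j) = Σ_{i > j} B(v_i, w_j)`" (eq. (explicit)); **Proposition 2.** "The bilinear form
`q_{1,2,…,n}` is symmetric." §2.2.3–2.2.4: `T_{1,2,…,n} = K_{1,2,…,n} / ker q`, "The symbol `τ_{1,2,…,n}` denotes the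
class of the quadratic space `(T_{1,2,…,n}, q_{1,2,…,n})` in `W(F)`, called the Maslov index of `l₁, …, lₙ`."
§4 **Proposition 5** (dihedral symmetry). "Under these identifications, `q_{2,3,…,n,1} = q_{1,2,…,n} = −q_{n,n−1,…,1}`."

Rendering (any field `K`, `B : LinearMap.BilinForm K V` — alternating where stated —, a family
`ℓ : Fin n → Submodule K V`):
* `polygonSpace ℓ ≤ (Fin n → V)` = `K_{1,…,n}` (families `v_i ∈ ℓ_i` with `Σ v_i = 0`);
* `polygonBilin B n` = the bilinear form `q(v, w) = Σ_{j < i} B(v_i, w_j)` of (explicit) on `Fin n → V`, and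
  `polygonForm B ℓ` = the quadratic form `v ↦ q(v, v)` on `polygonSpace ℓ`; **Prop. 2**: on `K_{1,…,n}` the form
  `q` is symmetric when `B` is alternating and the `ℓ_i` are isotropic (`polygonBilin_comm`), so that the polar
  form of `polygonForm` is `2q` (`polar_polygonForm`);
* `polygonWittIndex B ℓ := wittClass (polygonForm B ℓ) ∈ W(K)` = `τ_{1,…,n}` (Def. 2.2.4: the class of
  `(T, q)` is that of `(K, q)`, the tree's `wittClass` of a degenerate form being the class of its quadratic space);
* **Prop. 5**: cyclic invariance `τ(ℓ ∘ finRotate) = τ(ℓ)` realised by the isometry `v ↦ v ∘ finRotate`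
  (`polygonRotateIsometry`, `polygonWittIndex_rotate`; only `Σ v_i = 0` is used) and reversal
  `τ(ℓ ∘ rev) = −τ(ℓ)` realised by `v ↦ v ∘ rev` (`polygonRevIsometry`, `polygonWittIndex_rev`; `B` alternating);
* `n ≤ 2`: the form vanishes identically (`polygonForm_eq_zero_of_le_two`), so `τ = 0` — consistent with
  `dim T_{1,2} = 0` of [Thomas2006, (eq:dim)].
The chain condition (Prop. 6) and the comparison with Kashiwara's index (Prop. 11) are in the sequel
`MaslovIndexQuadraticSpaceChain.lean`.

## References

* [Thomas2006] T. Thomas, *The Maslov index as a quadratic space*, Math. Res. Lett. 13 (2006) 985–999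
  (arXiv:math/0505561): §2.2 Definitions 2.2.1–2.2.4, Remark 2 (eq. explicit), Proposition 2; §4 Proposition 5.
* [LionVergne1980] G. Lion, M. Vergne, *The Weil representation, Maslov index and Theta series*, PM 6 (1980),
  §1.5.12–1.5.13 (index of a sequence of Lagrangians, circular symmetry) — the signature version over `ℝ`.
-/

set_option autoImplicit false

noncomputable section

open QuadraticMap Module

namespace Literature.LinearAlgebra.QuadraticForm

universe u v

variable {K : Type u} [Field K]
variable {V : Type v} [AddCommGroup V] [Module K V]

/-! ## §2.2.1 The space `K_{1,…,n}` -/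

section Space

variable {n : ℕ} (ℓ : Fin n → Submodule K V)

/-- **`K_{1,2,…,n}`** = "the kernel of the natural summation `⊕ l_i → V`": families `(v_i)_{i}` with
`v_i ∈ ℓ_i` and `Σ_i v_i = 0`, as a subspace of `Fin n → V`. [cite: Thomas2006, §2.2.1 Definition] -/
def polygonSpace : Submodule K (Fin n → V) :=
  Submodule.pi Set.univ ℓ ⊓ LinearMap.ker (∑ i : Fin n, (LinearMap.proj i : (Fin n → V) →ₗ[K] V))

/-- membership in `K_{1,…,n}`. [cite: Thomas2006, §2.2.1 Definition] -/
theorem mem_polygonSpace_iff (v : Fin n → V) :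
    v ∈ polygonSpace ℓ ↔ (∀ i, v i ∈ ℓ i) ∧ ∑ i, v i = 0 := by
  rw [polygonSpace, Submodule.mem_inf, Submodule.mem_pi, LinearMap.mem_ker, LinearMap.sum_apply]
  simp only [Set.mem_univ, true_implies, LinearMap.coe_proj, Function.eval]

/-- components of a member lie in the Lagrangians. [cite: Thomas2006, §2.2.1 Definition] -/
theorem polygonSpace.mem (v : polygonSpace ℓ) (i : Fin n) : (v : Fin n → V) i ∈ ℓ i :=
  ((mem_polygonSpace_iff ℓ v).1 v.2).1 i

/-- the components of a member sum to zero. [cite: Thomas2006, §2.2.1 Definition] -/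
theorem polygonSpace.sum_eq_zero (v : polygonSpace ℓ) : ∑ i, (v : Fin n → V) i = 0 :=
  ((mem_polygonSpace_iff ℓ v).1 v.2).2

/-- re-indexing along a permutation `σ` of the vertices maps `K(ℓ)` onto `K(ℓ ∘ σ)`: `v ↦ v ∘ σ`.
[cite: Thomas2006, §4 ("`K_{1,…,n}` can be canonically identified with `K_{2,3,…,n,1}` and `K_{n,n−1,…,1}`")] -/
def polygonReindex (σ : Fin n ≃ Fin n) : polygonSpace ℓ ≃ₗ[K] polygonSpace (ℓ ∘ σ) where
  toFun v := ⟨fun i => (v : Fin n → V) (σ i), by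
    rw [mem_polygonSpace_iff]
    refine ⟨fun i => polygonSpace.mem ℓ v (σ i), ?_⟩
    rw [Equiv.sum_comp σ (fun i => (v : Fin n → V) i)]
    exact polygonSpace.sum_eq_zero ℓ v⟩
  invFun w := ⟨fun i => (w : Fin n → V) (σ.symm i), by
    rw [mem_polygonSpace_iff]
    refine ⟨fun i => ?_, ?_⟩
    · have h := polygonSpace.mem (ℓ ∘ σ) w (σ.symm i)
      rwa [Function.comp_apply, Equiv.apply_symm_apply] at h
    · rw [Equiv.sum_comp σ.symm (fun i => (w : Fin n → V) i)]
      exact polygonSpace.sum_eq_zero (ℓ ∘ σ) w⟩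
  map_add' v w := by ext i; rfl
  map_smul' c v := by ext i; rfl
  left_inv v := by ext i; simp only [Equiv.apply_symm_apply]
  right_inv w := by ext i; simp only [Equiv.symm_apply_apply]

/-- components of the re-indexed family. [cite: Thomas2006, §4] -/
@[simp] theorem coe_polygonReindex (σ : Fin n ≃ Fin n) (v : polygonSpace ℓ) (i : Fin n) :
    (polygonReindex ℓ σ v : Fin n → V) i = (v : Fin n → V) (σ i) := rfl

end Space

/-! ## §2.2.2 The form `q(v, w) = Σ_{j<i} B(v_i, w_j)` and its symmetry (Proposition 2) -/

section Form

variable (B : LinearMap.BilinForm K V)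

/-- the bilinear form `q(v, w) = Σ_{i > j} B(v_i, w_j)` on `Fin n → V` ([Thomas2006, Remark 2, eq. (explicit)] —
equal on `K_{1,…,n}` to the anti-derivative definition (defq)). [cite: Thomas2006, §2.2.2 Remark 2] -/
def polygonBilin (n : ℕ) : LinearMap.BilinForm K (Fin n → V) :=
  ∑ i : Fin n, ∑ j : Fin n, if j < i then (B.compl₁₂ (LinearMap.proj i) (LinearMap.proj j)) else 0

/-- `q(v, w) = Σ_i Σ_j [j < i] B(v_i, w_j)`. [cite: Thomas2006, §2.2.2 Remark 2] -/
theorem polygonBilin_apply (n : ℕ) (v w : Fin n → V) :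
    polygonBilin B n v w = ∑ i : Fin n, ∑ j : Fin n, if j < i then B (v i) (w j) else 0 := by
  simp only [polygonBilin, LinearMap.sum_apply]
  refine Finset.sum_congr rfl fun i _ => Finset.sum_congr rfl fun j _ => ?_
  split_ifs
  · rfl
  · rfl

variable {n : ℕ} (ℓ : Fin n → Submodule K V)

/-- **the Maslov form `v ↦ q(v, v) = Σ_{j<i} B(v_i, v_j)` on `K_{1,…,n}`** (the quadratic form of the space
`(K_{1,…,n}, q_{1,…,n})`). [cite: Thomas2006, §2.2.2–2.2.3] -/
def polygonForm : QuadraticForm K (polygonSpace ℓ) :=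
  (polygonBilin B n).toQuadraticMap.comp (polygonSpace ℓ).subtype

/-- `Q(v) = Σ_i Σ_j [j < i] B(v_i, v_j)`. [cite: Thomas2006, §2.2.2 Remark 2] -/
theorem polygonForm_apply (v : polygonSpace ℓ) :
    polygonForm B ℓ v = ∑ i : Fin n, ∑ j : Fin n, if j < i then B ((v : Fin n → V) i) ((v : Fin n → V) j) else 0 := by
  rw [polygonForm, QuadraticMap.comp_apply, LinearMap.BilinMap.toQuadraticMap_apply, Submodule.coe_subtype,
    polygonBilin_apply]

/-- the polar form of `Q` is `q(v, w) + q(w, v)`. [cite: Thomas2006, §2.2.2] -/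
theorem polar_polygonForm (v w : polygonSpace ℓ) :
    polar (polygonForm B ℓ) v w =
      polygonBilin B n (v : Fin n → V) (w : Fin n → V) + polygonBilin B n (w : Fin n → V) (v : Fin n → V) := by
  have h : polar (polygonForm B ℓ) v w =
      polar (polygonBilin B n).toQuadraticMap (v : Fin n → V) (w : Fin n → V) := by
    simp only [polar, polygonForm, QuadraticMap.comp_apply, Submodule.coe_subtype, Submodule.coe_add]
  rw [h, LinearMap.BilinMap.polar_toQuadraticMap]

/-- `Σ_i Σ_j B(v_i, w_j) = B(Σ v_i, Σ w_j)` (bilinearity). [folklore] -/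
private theorem sum_sum_eq (v w : Fin n → V) : ∑ i, ∑ j, B (v i) (w j) = B (∑ i, v i) (∑ j, w j) := by
  simp only [map_sum, LinearMap.sum_apply]
  exact Finset.sum_comm

/-- **[Thomas2006, Proposition 2]: `q` is symmetric on `K_{1,…,n}`** — for `B` alternating, `v_i, w_i ∈ ℓ_i`
isotropic and `Σ v_i = 0`: `q(v, w) − q(w, v) = Σ_{i ≠ j} B(v_i, w_j) = B(Σ v, Σ w) − Σ_i B(v_i, w_i) = 0`
("summation by parts"; eq. (alternate) `B(v_i, w_i) = 0`). [cite: Thomas2006, §2.2.2 Proposition 2] -/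
theorem polygonBilin_comm (hB : B.IsAlt) (iso : ∀ i, ∀ x ∈ ℓ i, ∀ y ∈ ℓ i, B x y = 0) {v w : Fin n → V}
    (hv : ∀ i, v i ∈ ℓ i) (hw : ∀ i, w i ∈ ℓ i) (hv0 : ∑ i, v i = 0) :
    polygonBilin B n v w = polygonBilin B n w v := by
  rw [polygonBilin_apply, polygonBilin_apply]
  -- `q(w, v) = Σ_i Σ_j [i < j] (-B(v_i, w_j))` after swapping the summation indices
  have hswap : (∑ i : Fin n, ∑ j : Fin n, if j < i then B (w i) (v j) else 0) =
      ∑ i : Fin n, ∑ j : Fin n, if i < j then -B (v i) (w j) else 0 := by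
    rw [Finset.sum_comm]
    refine Finset.sum_congr rfl fun i _ => Finset.sum_congr rfl fun j _ => ?_
    split_ifs
    · rw [LinearMap.IsAlt.neg hB]
    · rfl
  rw [hswap, ← sub_eq_zero, ← Finset.sum_sub_distrib]
  simp_rw [← Finset.sum_sub_distrib]
  -- pointwise `[j<i] B + [i<j] B = B - [i=j] B`
  have hpt : ∀ i j : Fin n, ((if j < i then B (v i) (w j) else 0) - if i < j then -B (v i) (w j) else 0) =
      B (v i) (w j) - if i = j then B (v i) (w j) else 0 := by
    intro i j
    rcases lt_trichotomy i j with h | h | h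
    · rw [if_neg (not_lt.2 h.le), if_pos h, if_neg h.ne]; ring
    · subst h; rw [if_neg (lt_irrefl _), if_neg (lt_irrefl _), if_pos rfl]; ring
    · rw [if_pos h, if_neg (not_lt.2 h.le), if_neg h.ne']
  simp_rw [hpt, Finset.sum_sub_distrib, Finset.sum_ite_eq, Finset.mem_univ, if_true]
  rw [sum_sum_eq B, hv0, map_zero, LinearMap.zero_apply, zero_sub, neg_eq_zero]
  exact Finset.sum_eq_zero fun i _ => iso i _ (hv i) _ (hw i)

/-- the polar form of the Maslov form is `2 q(v, w)` on `K_{1,…,n}` (`B` alternating, `ℓ_i` isotropic).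
[cite: Thomas2006, §2.2.2 Proposition 2] -/
theorem polar_polygonForm_eq_two_mul (hB : B.IsAlt) (iso : ∀ i, ∀ x ∈ ℓ i, ∀ y ∈ ℓ i, B x y = 0)
    (v w : polygonSpace ℓ) :
    polar (polygonForm B ℓ) v w = 2 * polygonBilin B n (v : Fin n → V) (w : Fin n → V) := by
  rw [polar_polygonForm, polygonBilin_comm B ℓ hB iso (polygonSpace.mem ℓ w) (polygonSpace.mem ℓ v)
    (polygonSpace.sum_eq_zero ℓ w), two_mul]

/-- for `n ≤ 2` the Maslov form vanishes identically (`B` alternating): `K_{1,2} = {(v, −v)}` and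
`q(v, v) = B(−v, v) = 0`. [cite: Thomas2006, §2.2.3 Corollary (eq:dim) (`dim T_{1,2} = 0`)] -/
theorem polygonForm_eq_zero_of_le_two (hB : B.IsAlt) (hn : n ≤ 2) : polygonForm B ℓ = 0 := by
  refine QuadraticMap.ext fun v => ?_
  rw [polygonForm_apply, QuadraticMap.zero_apply]
  refine Finset.sum_eq_zero fun i _ => Finset.sum_eq_zero fun j _ => ?_
  split_ifs with hji
  · -- then `j = 0`, `i = 1`, `n = 2` and `v_1 = -v_0`
    have hi1 : (i : ℕ) = 1 := by have := i.2; have := j.2; have : (j : ℕ) < i := hji; omega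
    have hj0 : (j : ℕ) = 0 := by have := i.2; have : (j : ℕ) < i := hji; omega
    have hsum := polygonSpace.sum_eq_zero ℓ v
    have huniv : ∀ k : Fin n, k = i ∨ k = j := fun k => by
      have := k.2
      rcases Nat.lt_or_ge (k : ℕ) 1 with h | h
      · right; exact Fin.ext (by omega)
      · left; exact Fin.ext (by omega)
    have hij : i ≠ j := fun h => by rw [h] at hi1; omega
    have hset : (Finset.univ : Finset (Fin n)) = {i, j} := by
      ext k
      simp only [Finset.mem_univ, Finset.mem_insert, Finset.mem_singleton, true_iff]
      exact huniv k
    rw [hset, Finset.sum_pair hij] at hsum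
    rw [eq_neg_of_add_eq_zero_left hsum, map_neg, LinearMap.neg_apply, hB, neg_zero]
  · rfl

variable [FiniteDimensional K V]

/-- **the Maslov index `τ(ℓ₁, …, ℓₙ) ∈ W(K)`**: "the class of the quadratic space `(T_{1,…,n}, q_{1,…,n})` in
`W(F)`, called the Maslov index of `l₁, …, lₙ`" — the Witt class of `(K_{1,…,n}, q)`, equal to that of its
non-degenerate quotient `T`. [cite: Thomas2006, §2.2.4 Definition] -/
def polygonWittIndex : WittGroup K :=
  wittClass (polygonForm B ℓ)

/-- unfolding. [cite: Thomas2006, §2.2.4 Definition] -/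
theorem polygonWittIndex_eq : polygonWittIndex B ℓ = wittClass (polygonForm B ℓ) := rfl

/-- `τ(ℓ₁, …, ℓₙ) = 0` for `n ≤ 2` (`B` alternating). [cite: Thomas2006, §2.2.3 Corollary (eq:dim)] -/
theorem polygonWittIndex_eq_zero_of_le_two (hB : B.IsAlt) (hn : n ≤ 2) : polygonWittIndex B ℓ = 0 := by
  rw [polygonWittIndex, polygonForm_eq_zero_of_le_two B ℓ hB hn]
  exact hasLagrangian_zero.wittClass_eq_zero

end Form

/-! ## §4 Dihedral symmetry (Proposition 5) -/

section Dihedral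

variable (B : LinearMap.BilinForm K V) {n : ℕ} (ℓ : Fin (n + 1) → Submodule K V)

/-- `finRotate` on `castSucc k` is `succ k` (plumbing). [folklore] -/
private theorem finRotate_castSucc (k : Fin n) : finRotate (n + 1) k.castSucc = k.succ := by
  rw [show k.castSucc = ⟨k.1, k.2.trans_le n.le_succ⟩ from rfl, finRotate_of_lt k.2]
  rfl

/-- the double sum `Σ_{j<i} f(i, j)` over `Fin (n+1)`, split at the vertex `0`:
`Σ_{j<i} f(i,j) = Σ_{i'} f(i'+1, 0) + Σ_{j'<i'} f(i'+1, j'+1)` (plumbing). [folklore] -/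
private theorem sum_sum_lt_succ {M : Type*} [AddCommMonoid M] (f : Fin (n + 1) → Fin (n + 1) → M) :
    (∑ i : Fin (n + 1), ∑ j : Fin (n + 1), if j < i then f i j else 0) =
      (∑ i : Fin n, f i.succ 0) + ∑ i : Fin n, ∑ j : Fin n, if j < i then f i.succ j.succ else 0 := by
  rw [Fin.sum_univ_succ]
  have h0 : (∑ j : Fin (n + 1), if j < (0 : Fin (n + 1)) then f 0 j else 0) = 0 :=
    Finset.sum_eq_zero fun j _ => by rw [if_neg (Fin.not_lt_zero j)]
  rw [h0, zero_add, ← Finset.sum_add_distrib]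
  refine Finset.sum_congr rfl fun i _ => ?_
  rw [Fin.sum_univ_succ, if_pos (Fin.succ_pos i)]
  simp only [Fin.succ_lt_succ_iff]

/-- the same double sum split at the LAST vertex:
`Σ_{j<i} f(i,j) = Σ_{j'<i'} f(i', j') + Σ_{j'} f(last, j')` over `castSucc` (plumbing). [folklore] -/
private theorem sum_sum_lt_castSucc {M : Type*} [AddCommMonoid M] (f : Fin (n + 1) → Fin (n + 1) → M) :
    (∑ i : Fin (n + 1), ∑ j : Fin (n + 1), if j < i then f i j else 0) =
      (∑ i : Fin n, ∑ j : Fin n, if j < i then f i.castSucc j.castSucc else 0) +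
        ∑ j : Fin n, f (Fin.last n) j.castSucc := by
  rw [Fin.sum_univ_castSucc]
  congr 1
  · refine Finset.sum_congr rfl fun i _ => ?_
    rw [Fin.sum_univ_castSucc, if_neg (not_lt.2 (Fin.le_last _)), add_zero]
    simp only [Fin.castSucc_lt_castSucc_iff]
  · rw [Fin.sum_univ_castSucc, if_neg (lt_irrefl _), add_zero]
    exact Finset.sum_congr rfl fun j _ => by rw [if_pos (Fin.castSucc_lt_last j)]

/-- **cyclic invariance of the Maslov form**: `Q_{ℓ ∘ σ}(v ∘ σ) = Q_ℓ(v)` for the rotation `σ = finRotate`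
(`ℓ ∘ σ = (ℓ₁, …, ℓₙ, ℓ₀)`); only `Σ v_i = 0` is used. [cite: Thomas2006, §4 Proposition 5 (cyclic symmetry)] -/
theorem polygonForm_rotate (v : polygonSpace ℓ) :
    polygonForm B (ℓ ∘ ⇑(finRotate (n + 1))) (polygonReindex ℓ (finRotate (n + 1)) v) = polygonForm B ℓ v := by
  rw [polygonForm_apply, polygonForm_apply]
  set u : Fin (n + 1) → V := (v : Fin (n + 1) → V) with hu
  have hcoe : ∀ i, (polygonReindex ℓ (finRotate (n + 1)) v : Fin (n + 1) → V) i = u (finRotate (n + 1) i) :=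
    fun i => rfl
  simp_rw [hcoe]
  rw [sum_sum_lt_castSucc, sum_sum_lt_succ]
  simp_rw [finRotate_castSucc, finRotate_last]
  -- the two boundary sums: `Σ_b B(u 0, u (b+1)) = B(u 0, -u 0) = B(-u 0, u 0) = Σ_a B(u (a+1), u 0)`
  have htail : ∑ k : Fin n, u k.succ = -u 0 := by
    have h := polygonSpace.sum_eq_zero ℓ v
    rw [Fin.sum_univ_succ] at h
    exact eq_neg_of_add_eq_zero_right h
  have h1 : ∑ j : Fin n, B (u 0) (u j.succ) = B (u 0) (-u 0) := by rw [← map_sum, htail]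
  have h2 : ∑ i : Fin n, B (u i.succ) (u 0) = B (-u 0) (u 0) := by
    rw [← htail, map_sum, LinearMap.sum_apply]
  rw [h1, h2, map_neg, map_neg, LinearMap.neg_apply, add_comm]

/-- **the rotation isometry `(K(ℓ), Q_ℓ) ≅ (K(ℓ ∘ σ), Q_{ℓ∘σ})`**, `σ = finRotate`.
[cite: Thomas2006, §4 Proposition 5 (cyclic symmetry)] -/
def polygonRotateIsometry :
    (polygonForm B ℓ).IsometryEquiv (polygonForm B (ℓ ∘ ⇑(finRotate (n + 1)))) where
  toLinearEquiv := polygonReindex ℓ (finRotate (n + 1))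
  map_app' v := polygonForm_rotate B ℓ v

/-- **[Thomas2006, Prop. 5], cyclic symmetry: `τ(ℓ₁, …, ℓₙ, ℓ₀) = τ(ℓ₀, ℓ₁, …, ℓₙ)`.**
[cite: Thomas2006, §4 Proposition 5] -/
theorem polygonWittIndex_rotate [FiniteDimensional K V] :
    polygonWittIndex B (ℓ ∘ ⇑(finRotate (n + 1))) = polygonWittIndex B ℓ :=
  (wittClass_eq_of_equivalent ⟨polygonRotateIsometry B ℓ⟩).symm

end Dihedral

section Reverse

variable (B : LinearMap.BilinForm K V) {n : ℕ} (ℓ : Fin n → Submodule K V)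

/-- **reversal negates the Maslov form**: `Q_{ℓ ∘ rev}(v ∘ rev) = −Q_ℓ(v)` for `B` alternating
(`Σ_{j<i} B(v_{rev i}, v_{rev j}) = Σ_{a<b} B(v_a, v_b) = −Σ_{b<a} B(v_a, v_b)`).
[cite: Thomas2006, §4 Proposition 5 (reversal)] -/
theorem polygonForm_rev (hB : B.IsAlt) (v : polygonSpace ℓ) :
    polygonForm B (ℓ ∘ ⇑Fin.revPerm) (polygonReindex ℓ Fin.revPerm v) = -polygonForm B ℓ v := by
  rw [polygonForm_apply, polygonForm_apply]
  set u : Fin n → V := (v : Fin n → V) with hu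
  have hcoe : ∀ i, (polygonReindex ℓ Fin.revPerm v : Fin n → V) i = u (Fin.rev i) := fun i => rfl
  simp_rw [hcoe]
  -- reindex both sums along `rev`
  rw [show (∑ i : Fin n, ∑ j : Fin n, if j < i then B (u (Fin.rev i)) (u (Fin.rev j)) else 0) =
      ∑ i : Fin n, ∑ j : Fin n, if i < j then B (u i) (u j) else 0 from by
    rw [← Equiv.sum_comp Fin.revPerm]
    refine Finset.sum_congr rfl fun i _ => ?_
    rw [← Equiv.sum_comp Fin.revPerm]
    refine Finset.sum_congr rfl fun j _ => ?_
    simp only [Fin.revPerm_apply, Fin.rev_rev, Fin.rev_lt_rev]]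
  rw [← Finset.sum_neg_distrib, Finset.sum_comm]
  refine Finset.sum_congr rfl fun j _ => ?_
  rw [← Finset.sum_neg_distrib]
  refine Finset.sum_congr rfl fun i _ => ?_
  split_ifs
  · rw [LinearMap.IsAlt.neg hB]
  · rw [neg_zero]

/-- **the reversal isometry `(K(ℓ), −Q_ℓ) ≅ (K(ℓ ∘ rev), Q_{ℓ∘rev})`** (`B` alternating).
[cite: Thomas2006, §4 Proposition 5 (reversal)] -/
def polygonRevIsometry (hB : B.IsAlt) :
    (-polygonForm B ℓ).IsometryEquiv (polygonForm B (ℓ ∘ ⇑Fin.revPerm)) where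
  toLinearEquiv := polygonReindex ℓ Fin.revPerm
  map_app' v := by
    rw [QuadraticMap.neg_apply]
    exact polygonForm_rev B ℓ hB v

/-- **[Thomas2006, Prop. 5], reversal: `τ(ℓₙ, …, ℓ₁) = −τ(ℓ₁, …, ℓₙ)`** (`B` alternating).
[cite: Thomas2006, §4 Proposition 5] -/
theorem polygonWittIndex_rev [FiniteDimensional K V] (hB : B.IsAlt) :
    polygonWittIndex B (ℓ ∘ ⇑Fin.revPerm) = -polygonWittIndex B ℓ := by
  rw [polygonWittIndex, polygonWittIndex, ← wittClass_neg]
  exact (wittClass_eq_of_equivalent ⟨polygonRevIsometry B ℓ hB⟩).symm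

end Reverse

end Literature.LinearAlgebra.QuadraticForm
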